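import Summits.BirchSwinnertonDyer.BirchSwinnertonDyer.Theorems.ManinLocalTwoThreeNotTrivialEisensteinModThreeMultiplicative
import Literature.NumberTheory.EllipticCurves.NewformPeterssonSizeSymmSquareProofs
import Literature.NumberTheory.EllipticCurves.ModularityVersionApProofs
import HarnessLib

/-!
# E-es-69♮ `NotTrivialEisensteinModThreeMultiplicative` holds UNCONDITIONALLY — the Carayol binder of p721078 §3 is removable
(route `ManinLocalTwoThree`, crux C3 `ManinPrimeToThreeAtNine` stmt-BirchSwinnertonDyer-22968; cell bsd-f2-manin, p2 gen 17, landing refuter ref1 g17's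
§R169 candidate proof `Ref1R169.notTrivialEisensteinModThreeMultiplicative_unconditional` (HOME/ref1/e169/ProbesP3.lean bdc7a9b3dca3b16f, farm rc 0,
std axioms) VERBATIM up to namespace, per -ty g20's 15:05Z routing; `--supports stmt-BirchSwinnertonDyer-22968`)

p3 gen 14 (p721078) proved es's law E-es-69♮ modulo the named fact `IsNewformOf.level_eq_conductorNorm` (Carayol).  ref1 §R169 observed the binder
is unnecessary: for the newform `f` of `W` at level `N` and `q ∥ N`, Atkin–Lehner gives `a_q(f)² = 1`
(`IsNewform0.cuspCoeff_sq_eq_one_of_dvd_of_not_sq_dvd`), so `a_q(W) ≠ 0`; `q ∣ N ⟺ q ∣ N_W` (`IsNewformOf.dvd_level_iff_dvd_conductorNorm`,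
Carayol-free) gives bad reduction, and `a_q(W) ≠ 0` excludes additive reduction (`LFunction_apply_eq_zero_of_not_good_of_not_mult`) ⟹
multiplicative at `q` ⟹ p3's §2 (`notTrivialEisensteinModThreeAt_of_hasMultiplicativeReductionAt'`).  PROVED here:
`hasMultiplicativeReductionAtPrime_of_isNewformOf_of_dvd_of_not_sq_dvd`, **`notTrivialEisensteinModThreeMultiplicative_holds :
NotTrivialEisensteinModThreeMultiplicative`** (BY NAME, unconditional), and es's EDGE 2 generic cut from E-es-69 alone
`threeAdicUnitWitness_noMuThree_of_h69'`.  BSD is not proved by this; C2/C3 OPEN. [folklore]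
-/

set_option autoImplicit false
-- lint-debt: the directory name repeats the summit name (sibling precedent `ManinLocalTwoThreeNotTrivialEisensteinModThreeMultiplicative.lean`)
set_option linter.dupNamespace false

noncomputable section

open scoped Classical Matrix MatrixGroups ModularForm

open NumberField IsDedekindDomain Field WeierstrassCurve CongruenceSubgroup
  Literature.NumberTheory.EllipticCurves Literature.NumberTheory.EllipticCurves.ModularForms
  Literature.NumberTheory.GaloisRepresentations
  Summit.BirchSwinnertonDyer.Rank1Residual.ManinAdditive
  Summit.BirchSwinnertonDyer.Rank1Residual.ManinAdditive.KatoCurve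
  Summit.BirchSwinnertonDyer.BirchSwinnertonDyer.Theorems.ManinLocalTwoThree

namespace Summit.BirchSwinnertonDyer.BirchSwinnertonDyer.Theorems.ManinLocalTwoThree.NotTrivialEisensteinUnconditional

/-- **`q ∥ N` for the newform of `W` ⟹ multiplicative reduction at `q`, WITHOUT Carayol** (Atkin–Lehner `a_q(f)² = 1`, ref1 §R169). [folklore] -/
theorem hasMultiplicativeReductionAtPrime_of_isNewformOf_of_dvd_of_not_sq_dvd (W : WeierstrassCurve ℚ) [W.IsElliptic]
    {N : ℕ} [NeZero N] {f : CuspForm (Gamma0 N) 2} (hf : IsNewformOf W f) {q : ℕ} [Fact q.Prime]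
    (hqN : q ∣ N) (hq2 : ¬ q ^ 2 ∣ N) : W.HasMultiplicativeReductionAtPrime q := by
  have hqp : q.Prime := Fact.out
  have hsq : cuspCoeff f q ^ 2 = 1 := hf.1.cuspCoeff_sq_eq_one_of_dvd_of_not_sq_dvd hqp hqN hq2
  have hne : W.LFunction q ≠ 0 := by
    intro h0
    have h := hf.2 q
    rw [h0] at h
    rw [h] at hsq
    norm_num at hsq
  have hbad : ¬ W.HasGoodReductionAtPrime q :=
    (W.dvd_conductorNorm_iff_not_hasGoodReductionAtPrime q).mp ((hf.dvd_level_iff_dvd_conductorNorm hqp).mp hqN)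
  by_contra hnm
  exact hne (WeierstrassCurve.LFunction_apply_eq_zero_of_not_good_of_not_mult W q hbad hnm (dvd_refl q))

/-- **es's law E-es-69♮ `NotTrivialEisensteinModThreeMultiplicative` HOLDS, unconditionally** (ref1 §R169's proof: the Carayol binder of
p721078 §3 is unnecessary).  Nothing about BSD, Manin's conjecture, C2 or C3 is proved by this. [folklore] -/
theorem notTrivialEisensteinModThreeMultiplicative_holds : NotTrivialEisensteinModThreeMultiplicative := by
  intro W _ N _ f hf h3 q hq hq3 hq2
  have hqp : q.Prime := Nat.prime_of_mem_primeFactors hq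
  haveI : Fact q.Prime := ⟨hqp⟩
  have hmultP : W.HasMultiplicativeReductionAtPrime q :=
    hasMultiplicativeReductionAtPrime_of_isNewformOf_of_dvd_of_not_sq_dvd W hf (Nat.dvd_of_mem_primeFactors hq) hq2
  set v : HeightOneSpectrum (𝓞 ℚ) := (Rat.HeightOneSpectrum.primesEquiv (R := 𝓞 ℚ)).symm ⟨q, hqp⟩ with hvdef
  have hvq : ((Rat.HeightOneSpectrum.primesEquiv v : Nat.Primes) : ℕ) = q := by rw [hvdef, Equiv.apply_symm_apply]
  have hv : ((q : ℕ) : 𝓞 ℚ) ∈ v.asIdeal := by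
    -- the rational prime below `v` lies in `v` (tree: `X11b.RoadFFMember.natCast_primesEquiv_mem_asIdeal`, inlined to keep the cone small)
    have h : (((Rat.HeightOneSpectrum.primesEquiv v : Nat.Primes) : ℕ) : 𝓞 ℚ) ∈ v.asIdeal := by
      have h := (Rat.HeightOneSpectrum.natGenerator_dvd_iff v).mp dvd_rfl
      rwa [← map_natCast (Rat.IsIntegralClosure.intEquiv (𝓞 ℚ)), Ideal.apply_mem_of_equiv_iff] at h
    rwa [hvq] at h
  have hmult : W.HasMultiplicativeReductionAt v := by
    have h := (hasMultiplicativeReductionAtPrime_iff_hasMultiplicativeReductionAt_ringOfIntegers W v)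
    rw [← h]
    convert hmultP using 2
  exact notTrivialEisensteinModThreeAt_of_hasMultiplicativeReductionAt' W h3 hqp hq3 v hv hmult

/-- **es's EDGE 2 generic cut from E-es-69 ALONE** (no Carayol binder). [folklore] -/
theorem threeAdicUnitWitness_noMuThree_of_h69' (h69 : ThreeAdicWitnessOfNotTrivialEisenstein) :
    ThreeAdicUnitWitnessOfNoRationalThreeTorsionOfNoMuThree :=
  threeAdicUnitWitness_noMuThree_of_h69 h69 notTrivialEisensteinModThreeMultiplicative_holds

end Summit.BirchSwinnertonDyer.BirchSwinnertonDyer.Theorems.ManinLocalTwoThree.NotTrivialEisensteinUnconditional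

end
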